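import Summits.Ventures.PercRepro.Night2ExcessMassIndep

/-!
# PercRepro — covering bases through a fat hyperplane (night-2, gen 21)

`Night2ExcessMassIndep` counts the loss mass of a target by its covering BASES (`coverBases`).  A rank-`≤ q` set
`H ⊇ K` of `G` (a hyperplane of `M|G` through the coloops — e.g. the closure of a NON-basis thin member, the «fat
a/m» objects of the `(7, 5)` residues) contains no covering basis, so the count drops from `C(|S ∖ K|, ρ)` to
`C(|S ∖ K|, ρ) − C(|(S ∖ K) ∩ H|, ρ)` (`card_coverBases_le_of_subset_rank`), and to `C(s, ρ) − C(s − m, ρ)` when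
`|G ∖ H| ≤ m` (`card_coverBases_le_of_fat`).  Numerically (proofs/NIGHT-2-g21.md §4) this single-hyperplane count does
NOT close a `(7, 5)` residue by itself; it is the first brick of the count `Σ_j #_j(s) E_j` of §5′.
-/

namespace PercRepro.Shadow

open Finset PerFlat ThmH

variable {α : Type*} [DecidableEq α] {M : Matroid α} [M.Finite]

open scoped Classical in
/-- **The count through a rank-`≤ q` set `H ⊇ K`** (a hyperplane of `M|G` through the coloops, e.g. the closure of a
non-basis thin member): no covering basis lies inside `H`, so
`#coverBases(S) ≤ C(|S ∖ K|, ρ) − C(|(S ∖ K) ∩ H|, ρ)`. -/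
theorem card_coverBases_le_of_subset_rank {q ρ : ℕ} {G : Finset α} (hk : kColoops M G + ρ = q + 1)
    {H : Finset α} (hKH : coloops M G ⊆ H) (hH : M.eRk (H : Set α) ≤ (q : ℕ∞)) (S : Finset α) :
    (coverBases M G S ρ).card + ((S \ coloops M G) ∩ H).card.choose ρ ≤ (S \ coloops M G).card.choose ρ := by
  have hsub : coverBases M G S ρ ⊆ (S \ coloops M G).powersetCard ρ \ ((S \ coloops M G) ∩ H).powersetCard ρ := by
    intro T hT
    unfold coverBases at hT
    rw [Finset.mem_filter] at hT
    obtain ⟨hTp, hind⟩ := hT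
    rw [Finset.mem_sdiff]
    refine ⟨hTp, ?_⟩
    intro hTH
    rw [Finset.mem_powersetCard] at hTp hTH
    have hTK : Disjoint (coloops M G) T := by
      rw [Finset.disjoint_left]
      intro x hx hxT
      exact (Finset.mem_sdiff.1 (hTp.1 hxT)).2 hx
    have hcard : (coloops M G ∪ T).card = q + 1 := by
      rw [Finset.card_union_of_disjoint hTK, ← kColoops_eq_card_coloops, hTp.2, hk]
    have hKT : ((coloops M G ∪ T : Finset α) : Set α) ⊆ (H : Set α) := by
      rw [Finset.coe_subset]
      exact Finset.union_subset hKH (hTH.1.trans Finset.inter_subset_right)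
    have h1 := hind.encard_le_eRk_of_subset hKT
    rw [Set.encard_coe_eq_coe_finsetCard, hcard] at h1
    have h2 : ((q + 1 : ℕ) : ℕ∞) ≤ (q : ℕ∞) := h1.trans hH
    have h3 : q + 1 ≤ q := by exact_mod_cast h2
    omega
  have hmono : ((S \ coloops M G) ∩ H).powersetCard ρ ⊆ (S \ coloops M G).powersetCard ρ :=
    Finset.powersetCard_mono Finset.inter_subset_left
  have h := Finset.card_le_card hsub
  rw [Finset.card_sdiff_of_subset hmono, Finset.card_powersetCard, Finset.card_powersetCard] at h
  have hle : ((S \ coloops M G) ∩ H).card.choose ρ ≤ (S \ coloops M G).card.choose ρ :=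
    Nat.choose_le_choose _ (Finset.card_le_card Finset.inter_subset_left)
  omega

open scoped Classical in
/-- **The count through a fat hyperplane**: if `H ⊇ K` has rank `≤ q` and `|G ∖ H| ≤ m`, every target `S ⊆ G` has
at most `C(|S ∖ K|, ρ) − C(|S ∖ K| − m, ρ)` covering bases. -/
theorem card_coverBases_le_of_fat {q ρ m : ℕ} {G : Finset α} (hk : kColoops M G + ρ = q + 1)
    {H : Finset α} (hKH : coloops M G ⊆ H) (hH : M.eRk (H : Set α) ≤ (q : ℕ∞)) (hm : (G \ H).card ≤ m)
    {S : Finset α} (hSG : S ⊆ G) :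
    (coverBases M G S ρ).card + ((S \ coloops M G).card - m).choose ρ ≤ (S \ coloops M G).card.choose ρ := by
  have h := card_coverBases_le_of_subset_rank hk hKH hH S
  have hin : (S \ coloops M G).card - m ≤ ((S \ coloops M G) ∩ H).card := by
    have e1 : (S \ coloops M G) ∩ H = (S \ coloops M G) \ ((S \ coloops M G) \ H) := by
      ext x
      simp only [Finset.mem_inter, Finset.mem_sdiff, not_and, not_not]
      constructor
      · rintro ⟨⟨hxS, hxK⟩, hxH⟩
        exact ⟨⟨hxS, hxK⟩, fun _ => hxH⟩
      · rintro ⟨⟨hxS, hxK⟩, hxH⟩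
        exact ⟨⟨hxS, hxK⟩, hxH ⟨hxS, hxK⟩⟩
    have e2 : ((S \ coloops M G) \ H).card ≤ m := by
      calc ((S \ coloops M G) \ H).card ≤ (G \ H).card :=
            Finset.card_le_card (fun x hx => by
              rw [Finset.mem_sdiff] at hx ⊢
              exact ⟨hSG (Finset.mem_sdiff.1 hx.1).1, hx.2⟩)
        _ ≤ m := hm
    rw [e1, Finset.card_sdiff_of_subset Finset.sdiff_subset]
    omega
  have hle : ((S \ coloops M G).card - m).choose ρ ≤ ((S \ coloops M G) ∩ H).card.choose ρ :=
    Nat.choose_le_choose _ hin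
  omega

end PercRepro.Shadow
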